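import Summits.Ventures.PercRepro.CoreRepresentableBound

/-!
# C-030, representable case — the bound in the rank

`card_le_choose_of_basis`: the bound of `CoreRepresentableBound` for points of any vector space with a
finite basis; `card_le_choose_finrank`: `|E| ≤ C(r + 1, 2)` with `r = dim span v(E)`, the rank of the
represented matroid.  Paper: HOME/proofs/P3-C030-representable.md (p3 g20).
-/

namespace PercRepro
namespace RepCore

open Module Finset

variable {F : Type*} [Field F] {α : Type*}

/-- Membership in a span is preserved and reflected by an injective linear map. -/
theorem mem_span_iff_map {W W' : Type*} [AddCommGroup W] [Module F W] [AddCommGroup W'] [Module F W']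
    (L : W →ₗ[F] W') (hL : Function.Injective L) (s : Set W) (x : W) :
    x ∈ Submodule.span F s ↔ L x ∈ Submodule.span F (L '' s) := by
  rw [← Submodule.map_span]
  constructor
  · exact fun h => Submodule.mem_map_of_mem h
  · intro h
    obtain ⟨y, hy, hyx⟩ := Submodule.mem_map.1 h
    rwa [hL hyx] at hy

/-- The bound of `card_le_choose` for points of an arbitrary vector space `W` with a basis indexed by
a finite type `ι`: `|E| ≤ C(card ι + 1, 2)`. -/
theorem card_le_choose_of_basis {ι : Type*} [Fintype ι] [DecidableEq ι] {W : Type*} [AddCommGroup W]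
    [Module F W] (b : Basis ι F W) (E : Finset α) (v : α → W)
    (h : ∀ e ∈ E, ∃ A ⊆ (↑E : Set α) \ {e}, v e ∉ Submodule.span F (v '' A) ∧
      v e ∉ Submodule.span F (v '' (((↑E : Set α) \ {e}) \ A))) :
    E.card ≤ (Fintype.card ι + 1).choose 2 := by
  classical
  let L : W →ₗ[F] (ι → F) :=
    (Finsupp.linearEquivFunOnFinite F F ι).toLinearMap ∘ₗ b.repr.toLinearMap
  have hL : Function.Injective L :=
    (Finsupp.linearEquivFunOnFinite F F ι).injective.comp b.repr.injective
  refine card_le_choose E (fun x => L (v x)) fun e he => ?_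
  obtain ⟨A, hA, h₁, h₂⟩ := h e he
  refine ⟨A, hA, ?_, ?_⟩
  · rw [show (fun x => L (v x)) '' A = L '' (v '' A) from Set.image_comp L v A]
    exact fun hmem => h₁ ((mem_span_iff_map L hL _ _).2 hmem)
  · rw [show (fun x => L (v x)) '' (((↑E : Set α) \ {e}) \ A) = L '' (v '' (((↑E : Set α) \ {e}) \ A))
      from Set.image_comp L v _]
    exact fun hmem => h₂ ((mem_span_iff_map L hL _ _).2 hmem)

/-- **C-030, representable case, in the rank**: `|E| ≤ C(r + 1, 2)` with `r = dim span v(E)` — the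
rank of the represented matroid. -/
theorem card_le_choose_finrank {W : Type*} [AddCommGroup W] [Module F W] (E : Finset α) (v : α → W)
    (h : ∀ e ∈ E, ∃ A ⊆ (↑E : Set α) \ {e}, v e ∉ Submodule.span F (v '' A) ∧
      v e ∉ Submodule.span F (v '' (((↑E : Set α) \ {e}) \ A))) :
    E.card ≤ (Module.finrank F (Submodule.span F (v '' (↑E : Set α))) + 1).choose 2 := by
  classical
  set S : Submodule F W := Submodule.span F (v '' (↑E : Set α)) with hS
  haveI : FiniteDimensional F S := FiniteDimensional.span_of_finite F (E.finite_toSet.image v)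
  let v' : α → S := fun x => if hx : x ∈ E then ⟨v x, Submodule.subset_span ⟨x, hx, rfl⟩⟩ else 0
  have hv' : ∀ x ∈ E, ((v' x : S) : W) = v x := fun x hx => by simp [v', hx]
  have key : ∀ T ⊆ (↑E : Set α), S.subtype '' (v' '' T) = v '' T := by
    intro T hT
    ext w
    constructor
    · rintro ⟨_, ⟨x, hx, rfl⟩, rfl⟩
      exact ⟨x, hx, by rw [Submodule.subtype_apply, hv' x (hT hx)]⟩
    · rintro ⟨x, hx, rfl⟩
      exact ⟨v' x, ⟨x, hx, rfl⟩, by rw [Submodule.subtype_apply, hv' x (hT hx)]⟩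
  have hb := card_le_choose_of_basis (Module.finBasis F S) E v' ?_
  · simpa using hb
  · intro e he
    obtain ⟨A, hA, h₁, h₂⟩ := h e he
    have hA' : A ⊆ (↑E : Set α) := hA.trans Set.sdiff_subset
    have hB' : ((↑E : Set α) \ {e}) \ A ⊆ (↑E : Set α) := Set.sdiff_subset.trans Set.sdiff_subset
    refine ⟨A, hA, ?_, ?_⟩
    · intro hmem
      apply h₁
      have := (mem_span_iff_map S.subtype S.injective_subtype (v' '' A) (v' e)).1 hmem
      rwa [key A hA', Submodule.subtype_apply, hv' e he] at this
    · intro hmem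
      apply h₂
      have := (mem_span_iff_map S.subtype S.injective_subtype _ (v' e)).1 hmem
      rwa [key _ hB', Submodule.subtype_apply, hv' e he] at this

end RepCore
end PercRepro
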